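import Summits.CriticalPhenomena.PercolationContinuityZ3.Theorems.PercNearOneGluingNoHeavyLowerTailSunflowerAttach
import Summits.CriticalPhenomena.PercolationContinuityZ3.Theorems.PercNearOneGluingNoHeavyLowerTailSunflowerSafeTransport
import Summits.CriticalPhenomena.PercolationContinuityZ3.Theorems.PercNearOneGluingNoHeavyLowerTailSunflowerBipartiteCorollaries
import HarnessLib

/-!
# `NoHeavyLowerTail` (crux stmt-CriticalPhenomena-4575), abstract sunflower cubic: `TriangleFreeSafe` FOLLOWS FROM HIT-CONDITIONED SAFETY

Support file (seat `prim-ineq-prove-1` gen 49; `--supports stmt-CriticalPhenomena-4575`).  No `sorry`, no named facts.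
Memo: run/shared/lean/prim/prim-ineq-prove-1/FINDING-PENDANT-prove1-g49.md §6 (THEOREM 4).

**`triangleFreeSafe_of_hitSafe`**: if every triangle-free graph core on `Fin m` is hit-conditioned safe (`SafeCalc.Attach.HitSafe`,
`…SunflowerAttach`) with respect to every independent set `N` at every parameter vector, then `SafeCalc.TriangleFreeSafe` (G△:
every triangle-free graph core is A-safe) holds.  Induction on the number of vertices: a graph `Γ` on `Fin (n+1)` is the graph
`Γ₀` obtained by isolating the last vertex `z` plus the star from `z` to its (independent) neighbourhood `N`; `edgeCore Γ₀` is
the cylinder (`…SafeTransport.cylEv`) of the core of `Γ` restricted to `Fin n`, A-safe by induction and `safe_cylEv`; the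
hypothesis supplies `HitSafe` for `(Γ₀, N)`; `Attach.aSafe_union_attach` concludes.  The base case is the bipartite (empty) graph.
So the conjecture G△ is reduced to a statement about ONE graph at a time (no induction): Lemma A for its core under the law
conditioned on meeting an independent set — typed here as `@[conjecture] TriangleFreeHitSafe` (true in every census so far, memo §6;
`triangleFreeSafe_of_triangleFreeHitSafe`).
-/

noncomputable section

namespace Summit.CriticalPhenomena.PercolationContinuityZ3.Theorems.SunflowerPartition

namespace SafeCalc

open MeasureTheory Finset
open Literature.Probability.LatticeModels Literature.Probability.Percolation
open Attach

/-- The graph `Γ` with its last vertex isolated: the restriction to `Fin n` mapped back along `castSucc`. [this work] -/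
def isolateLast {n : ℕ} (Γ : SimpleGraph (Fin (n + 1))) : SimpleGraph (Fin (n + 1)) :=
  SimpleGraph.map Fin.castSuccEmb (Γ.comap Fin.castSuccEmb)

/-- Adjacency in `isolateLast Γ`: adjacency in `Γ` away from the last vertex. [this work] -/
theorem isolateLast_adj {n : ℕ} (Γ : SimpleGraph (Fin (n + 1))) (a b : Fin (n + 1)) :
    (isolateLast Γ).Adj a b ↔ Γ.Adj a b ∧ a ≠ Fin.last n ∧ b ≠ Fin.last n := by
  unfold isolateLast
  rw [SimpleGraph.map_adj]
  constructor
  · rintro ⟨a', b', hab, rfl, rfl⟩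
    exact ⟨hab, Fin.castSucc_ne_last a', Fin.castSucc_ne_last b'⟩
  · rintro ⟨hab, ha, hb⟩
    obtain ⟨a', rfl⟩ := Fin.exists_castSucc_eq.2 ha
    obtain ⟨b', rfl⟩ := Fin.exists_castSucc_eq.2 hb
    exact ⟨a', b', hab, rfl, rfl⟩

/-- The core of `isolateLast Γ` is the cylinder of the core of `Γ` restricted to `Fin n`. [this work] -/
theorem edgeCore_isolateLast {n : ℕ} (Γ : SimpleGraph (Fin (n + 1))) :
    edgeCore (isolateLast Γ) = cylEv Fin.castSuccEmb (edgeCore (Γ.comap Fin.castSuccEmb)) := by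
  ext ω
  simp only [edgeCore, cylEv, SimpleGraph.comap_adj, Set.mem_setOf_eq, isolateLast_adj]
  constructor
  · rintro ⟨a, b, ⟨hab, ha, hb⟩, haω, hbω⟩
    obtain ⟨a', rfl⟩ := Fin.exists_castSucc_eq.2 ha
    obtain ⟨b', rfl⟩ := Fin.exists_castSucc_eq.2 hb
    exact ⟨a', b', hab, haω, hbω⟩
  · rintro ⟨a', b', hab, ha, hb⟩
    exact ⟨Fin.castSucc a', Fin.castSucc b', ⟨hab, Fin.castSucc_ne_last a', Fin.castSucc_ne_last b'⟩, ha, hb⟩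

/-- `Γ` is `isolateLast Γ` plus the star from the last vertex to its neighbourhood, at the level of cores. [this work] -/
theorem edgeCore_eq_isolateLast_union {n : ℕ} (Γ : SimpleGraph (Fin (n + 1))) [DecidableRel Γ.Adj] :
    edgeCore Γ = edgeCore (isolateLast Γ) ∪ attachEv (Fin.last n) (univ.filter fun x => Γ.Adj (Fin.last n) x) := by
  ext ω
  simp only [edgeCore, isolateLast_adj, attachEv, hit, Set.mem_setOf_eq, Set.mem_union, Set.mem_inter_iff, mem_filter, mem_univ,
    true_and]
  constructor
  · rintro ⟨a, b, hab, ha, hb⟩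
    by_cases haz : a = Fin.last n
    · subst haz; exact Or.inr ⟨ha, b, hab, hb⟩
    by_cases hbz : b = Fin.last n
    · subst hbz; exact Or.inr ⟨hb, a, hab.symm, ha⟩
    exact Or.inl ⟨a, b, ⟨hab, haz, hbz⟩, ha, hb⟩
  · rintro (⟨a, b, ⟨hab, -, -⟩, ha, hb⟩ | ⟨hz, x, hzx, hx⟩)
    · exact ⟨a, b, hab, ha, hb⟩
    · exact ⟨Fin.last n, x, hzx, hz, hx⟩

/-- Restricting a triangle-free graph to `Fin n` keeps it triangle-free. [this work] -/
theorem cliqueFree_comap_castSucc {n : ℕ} {Γ : SimpleGraph (Fin (n + 1))} (hΓ : Γ.CliqueFree 3) :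
    (Γ.comap Fin.castSuccEmb).CliqueFree 3 :=
  hΓ.comap ⟨(SimpleGraph.Embedding.comap Fin.castSuccEmb Γ).toCopy⟩

/-- `isolateLast Γ` is a subgraph of `Γ`, hence triangle-free when `Γ` is. [this work] -/
theorem cliqueFree_isolateLast {n : ℕ} {Γ : SimpleGraph (Fin (n + 1))} (hΓ : Γ.CliqueFree 3) : (isolateLast Γ).CliqueFree 3 :=
  hΓ.anti fun a b h => ((isolateLast_adj Γ a b).1 h).1

/-- **Conjecture (hit-conditioned safety of triangle-free cores).**  For every triangle-free graph `Δ` on `Fin m`, every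
`Δ`-independent vertex set `N` and every parameter vector, `edgeCore Δ` is hit-conditioned safe w.r.t. `N` (`Attach.HitSafe`):
Lemma A in product form holds under the law conditioned on `ω` meeting `N`.  Evidence: exact census (kit j195172: 41 graphs incl. all
triangle-free graphs on ≤ 6 vertices, C₇–C₉, M₈, X₉, Petersen, Q₃; 990 865 cases; 0 violations); proved for bipartite `Δ` with `N`
inside one side; false without "independent" and false for two hitting events (memo §6).  An obligation of this programme, never
used as a fact; by `triangleFreeSafe_of_hitSafe` it implies `TriangleFreeSafe`. [conjecture, this work] -/
@[conjecture] def TriangleFreeHitSafe : Prop :=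
  ∀ (m : ℕ) (Δ : SimpleGraph (Fin m)) (N : Finset (Fin m)), Δ.CliqueFree 3 →
    (∀ x ∈ N, ∀ y ∈ N, ¬ Δ.Adj x y) → ∀ q : Fin m → unitInterval, HitSafe q N (edgeCore Δ)

/-- **G△ FOLLOWS FROM HIT-CONDITIONED SAFETY.**  If for every triangle-free graph `Δ` on `Fin m` and every `Δ`-independent `N`
the core `edgeCore Δ` is hit-conditioned safe w.r.t. `N` at every parameter vector, then every triangle-free graph core is A-safe
(`TriangleFreeSafe`). [this work] -/
theorem triangleFreeSafe_of_hitSafe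
    (H : ∀ (m : ℕ) (Δ : SimpleGraph (Fin m)) (N : Finset (Fin m)), Δ.CliqueFree 3 →
      (∀ x ∈ N, ∀ y ∈ N, ¬ Δ.Adj x y) → ∀ q : Fin m → unitInterval, HitSafe q N (edgeCore Δ)) :
    TriangleFreeSafe := by
  intro n
  induction n with
  | zero =>
    intro Γ _ p
    exact Bridge.safe_edgeCore_of_isBipartite Γ (SimpleGraph.Colorable.of_isEmpty 2) p
  | succ n ih =>
    intro Γ hΓ p
    classical
    set z : Fin (n + 1) := Fin.last n with hz
    set N : Finset (Fin (n + 1)) := univ.filter fun x => Γ.Adj z x with hN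
    set Γ' : SimpleGraph (Fin n) := Γ.comap Fin.castSuccEmb with hΓ'
    have hA' : ∀ q : Fin n → unitInterval, Safe q (edgeCore Γ') := ih Γ' (cliqueFree_comap_castSucc hΓ)
    -- the isolated-vertex core is A-safe (transport along `castSucc`)
    have hA0 : ∀ q : Fin (n + 1) → unitInterval, Safe q (edgeCore (isolateLast Γ)) := by
      intro q
      rw [edgeCore_isolateLast]
      exact safe_cylEv q Fin.castSuccEmb (hA' _)
    -- `N` is independent (triangle-freeness) and avoids `z`
    have hzN : z ∉ N := by
      rw [hN, mem_filter]; exact fun h => Γ.irrefl h.2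
    have hNind : ∀ x ∈ N, ∀ y ∈ N, ¬ (isolateLast Γ).Adj x y := by
      intro x hx y hy hxy
      rw [hN, mem_filter] at hx hy
      exact hΓ {z, x, y} (SimpleGraph.is3Clique_triple_iff.2 ⟨hx.2, hy.2, ((isolateLast_adj Γ x y).1 hxy).1⟩)
    have hH : ∀ q : Fin (n + 1) → unitInterval, HitSafe q N (edgeCore (isolateLast Γ)) :=
      H (n + 1) (isolateLast Γ) N (cliqueFree_isolateLast hΓ) hNind
    -- the core of `isolateLast Γ` does not depend on `z`
    have hd : DeterminedBy (edgeCore (isolateLast Γ)) (↑(univ.erase z : Finset (Fin (n + 1))) : Set (Fin (n + 1))) := by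
      rw [coe_univ_erase_eq_compl]
      exact determinedBy_edgeCore_of_isolated_one (isolateLast Γ) fun w h => ((isolateLast_adj Γ z w).1 h).2.1 rfl
    rw [edgeCore_eq_isolateLast_union Γ]
    exact aSafe_union_attach hzN hd (isUpperSet_edgeCore _) hA0 hH p

/-- The named form: `TriangleFreeHitSafe → TriangleFreeSafe`. [this work] -/
theorem triangleFreeSafe_of_triangleFreeHitSafe (h : TriangleFreeHitSafe) : TriangleFreeSafe :=
  triangleFreeSafe_of_hitSafe h

end SafeCalc

end Summit.CriticalPhenomena.PercolationContinuityZ3.Theorems.SunflowerPartition
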